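import Summits.QuantumFields.BalabanUV.T4Continuum.Support.SubstrateRawSpecies

/-!
# SUBSTRATE — THE COVARIANCE SPECIES AS FUNCTIONS OF TWO-SIDED TRANSPORTER DATA `(R, S)` (the complexified-group reading `U* ↦ U⁻¹` of
# [Balaban1985BackgroundPropagators] Sect. B pp. 399–400), THEIR AGREEMENT WITH THE SPECIES OF RECORD ON THE REAL SLICE `S = Rᴴ`, AND THE
# EXPONENTIAL CHART `A ↦ e^{A}·R⁰` — [dict] D-8 (i)–(iii) (NE9 owner OBJ-NE9-g30-1, l.14179; follower of `SubstrateRawSpecies` p219509)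

Cell `pub-balaban`, SUBSTRATE cell, seat `b2b-balaban-substrate-p1`.  Summits-side under the LEAN PLACEMENT RULE.  HONEST FRAMING: rung (B)+1 of the
FINITE-VOLUME T⁴ programme — NOT infinite volume, NOT a mass gap, NOT Clay; spine PROVED 0∕9; NE9 NOT proved.  This file is ALGEBRA ONLY: the
kernel block of the species of record (`covLapOf`, `QcovOf`, `deltaQOf`, `greenOf`, `unitCovOf`) rewritten as functions of a PAIR of transporter
fields `R` (bond transporters) and `S` (their «adjoints»), with every conjugate transpose of a transporter-built block replaced by the same
block built from `S` — so that the species are POLYNOMIAL ∕ RATIONAL in `(R, S)` (holomorphy is then the consumer's one-liner) — and the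
identities saying that at `S = adjOf R := (R ν i)ᴴ` (the real slice; `= (R ν i)⁻¹` for unitary transporters, `adjOf_eq_inv`) they ARE the
species of record.  Printed warrant for the reading (KIND only, nothing asserted): [Balaban1985BackgroundPropagators] p. 393 «These definitions
extend straightforwardly to configurations U, A with values in the complexified group Gᶜ», Sect. B pp. 399–400, and p. 406 «for complex
configurations … F*₂,ⱼ(A) is not the adjoint of F₂,ⱼ(A)».  No estimate; no invertibility claimed (`greenT` is Mathlib's total inverse).
HONEST DEPENDENCY (cell line, verbatim): continuum YM on T⁴ ⇐ BetaPertH ∧ nine spine estimates (0/9 proved); BetaPertH ⇐ (D1) ∧ (D4) ∧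
CAP+tail; G-an2-4 gates asym, D1 and NE2/3/4.

WHAT.
* §1 `adjOf R`, `adjOf_adjOf`, `adjOf_eq_inv` (unitary); `transportA S μ Γ` (reversed product) with `transportA_adjOf : transportA (adjOf R) = (transport R)ᴴ`.
* §2 the two-sided kernel block on one level: `covDcA c S ν`, `covLapT c R S := Σ_ν covDcA c S ν * covDc c R ν`, `QcovA Γ S`, `deltaQT c a Γ R S
  := covLapT + a·(QcovA S * Qcov R)`, `greenT := (deltaQT)⁻¹`, `unitCovT s Γ R S := s·(Qcov R * greenT * QcovA S)`; real-slice identities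
  `covDcA_adjOf`, `covLapT_adjOf : covLapT c R (adjOf R) = covLapC c R`, `QcovA_adjOf : QcovA Γ (adjOf R) = (Qcov Γ R)ᴴ`, `deltaQT_adjOf`.
* §3 agreement with the species of record (V1 `U`, chart `transV`): `covLapOf_eq_covLapT`, `deltaQOf_eq_deltaQT`, `greenOf_eq_greenT`,
  **`unitCovOf_eq_unitCovT`** — `S.rawB`'s `.cov` block factors through the transporter data DEFINITIONALLY (D-8 (i)).
* §5 the tower: `TowerData P o` (one transporter field per NE2 level `k ≤ K` — the finite-dimensional chart domain), `towerDataOf P ι av U`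
  (transporters of the block averages `M^{K−k} U` — the backgrounds of record), `covAtT`, `rawTOfRecord` (+ `lastCouplingOnly_rawTOfRecord`), and
  the record-level agreements **`covAtOfRecord_eq_covAtT`**, **`rawOfRecord_eq_rawTOfRecord`** (letters read through the tower data).
* §4 the exponential chart (D-8 (iii)): `expChart R⁰ A ν i := exp (A ν i) * R⁰ ν i`, `expChartInv R⁰ A ν i := (R⁰ ν i)⁻¹ * exp (−A ν i)`;
  `expChart_zero`, `expChartInv_mul_expChart` ∕ `expChart_mul_expChartInv` (unitary `R⁰`), and the REAL FORM: for unitary `R⁰` and skew-Hermitian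
  `A`, `adjOf (expChart R⁰ A) = expChartInv R⁰ A` and `expChart R⁰ A ν i ∈ unitaryGroup` (`adjOf_expChart`, `expChart_mem_unitaryGroup`).
Imports `SubstrateRawSpecies` only; nothing existing is modified.
-/

noncomputable section

open scoped BigOperators Matrix Kronecker ComplexConjugate

namespace Summit.QuantumFields.BalabanUV.T4Continuum.SubstrateTransporterSpecies

open Literature.MathematicalPhysics.QuantumFieldTheory.Balaban1983to89
open Literature.MathematicalPhysics.QuantumFieldTheory.Balaban1983to89.B5Prop11Plancherel (Tor shiftM fine)
open Literature.MathematicalPhysics.QuantumFieldTheory.Balaban1983to89.B5Block118 (bpt tstep)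
open Literature.MathematicalPhysics.QuantumFieldTheory.Balaban1983to89.B5G183RateUnitTower (lev lev_neZero)
open Summit.QuantumFields.BalabanUV.T4Continuum.BlockMultiplication (siteMul siteMul_conjTranspose)
open Summit.QuantumFields.BalabanUV.T4Continuum.ColourCovariantLaplacian (covDc covLapC)
open Summit.QuantumFields.BalabanUV.T4Continuum.CovariantBlockAveraging (transport ContourSystem Qcov)
open Summit.QuantumFields.BalabanUV.T4Continuum.SubstrateBackgroundTransporters
open Summit.QuantumFields.BalabanUV.T4Continuum.SubstrateCovariantAveraging (QcovOf deltaQOf)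
open Summit.QuantumFields.BalabanUV.T4Continuum.B13OpDatum (RawSpecies)
open Summit.QuantumFields.BalabanUV.T4Continuum.SubstrateRawSpecies (greenOf unitCovOf)

variable {d : ℕ} {o : Type*} [Fintype o] [DecidableEq o]

/-! ## §1 Two-sided transporter data: the adjoint field and reversed transports -/

section Adj

variable {ι : Type*}

/-- [folklore] The ADJOINT transporter field `(adjOf R) ν i := (R ν i)ᴴ` — the real-slice value of the second variable `S`. -/
def adjOf (R : Fin d → (ι → Matrix o o ℂ)) : Fin d → (ι → Matrix o o ℂ) := fun ν i => (R ν i)ᴴ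

omit [Fintype o] [DecidableEq o] in
/-- [folklore] `adjOf` unfolds. -/
@[simp] theorem adjOf_apply (R : Fin d → (ι → Matrix o o ℂ)) (ν : Fin d) (i : ι) : adjOf R ν i = (R ν i)ᴴ := rfl

omit [Fintype o] [DecidableEq o] in
/-- [folklore] `adjOf` is an involution. -/
theorem adjOf_adjOf (R : Fin d → (ι → Matrix o o ℂ)) : adjOf (adjOf R) = R := by
  funext ν i; simp [adjOf]

/-- [folklore] **`U* = U⁻¹` ON THE GROUP**: for unitary transporters the adjoint field IS the inverse field — the identity by which the
two-sided species below extend the species of record to the complexified group ([Balaban1985BackgroundPropagators] Sect. B, KIND). -/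
theorem adjOf_eq_inv {R : Fin d → (ι → Matrix o o ℂ)} (hR : ∀ ν i, R ν i ∈ Matrix.unitaryGroup o ℂ) :
    adjOf R = fun ν i => (R ν i)⁻¹ := by
  funext ν i
  have h : star (R ν i) * R ν i = 1 := Matrix.mem_unitaryGroup_iff'.1 (hR ν i)
  rw [adjOf_apply, ← Matrix.star_eq_conjTranspose]
  exact (Matrix.inv_eq_left_inv h).symm

end Adj

section Transport

variable (Nf : Fin d → ℕ) [hNf : ∀ μ, NeZero (Nf μ)]

/-- [folklore] **ADJOINT TRANSPORT along a bond list** read in colour slot `μ`: the REVERSED product `Π_{(x,ν)∈Γ, reversed} S_ν(x, μ)` — the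
formula of `(transport R μ Γ)ᴴ` with each `(R_ν(x, μ))ᴴ` replaced by `S_ν(x, μ)`. -/
def transportA (S : Fin d → (Tor Nf × Fin d → Matrix o o ℂ)) (μ : Fin d) (Γ : List (Tor Nf × Fin d)) : Matrix o o ℂ :=
  ((Γ.map fun b => S b.2 (b.1, μ)).reverse).prod

omit hNf in
/-- [folklore] **REAL SLICE**: at `S = adjOf R` the adjoint transport IS the conjugate transpose of the transport. -/
theorem transportA_adjOf (R : Fin d → (Tor Nf × Fin d → Matrix o o ℂ)) (μ : Fin d) (Γ : List (Tor Nf × Fin d)) :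
    transportA Nf (adjOf R) μ Γ = (transport Nf R μ Γ)ᴴ := by
  rw [transportA, transport, Matrix.conjTranspose_list_prod, List.map_map]
  rfl

omit hNf in
/-- [folklore] Adjoint transport along the empty list is `1`. -/
@[simp] theorem transportA_nil (S : Fin d → (Tor Nf × Fin d → Matrix o o ℂ)) (μ : Fin d) : transportA Nf S μ [] = 1 := by
  simp [transportA]

omit hNf in
/-- [folklore] Concatenated contours multiply in REVERSED order. -/
theorem transportA_append (S : Fin d → (Tor Nf × Fin d → Matrix o o ℂ)) (μ : Fin d) (Γ Γ' : List (Tor Nf × Fin d)) :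
    transportA Nf S μ (Γ ++ Γ') = transportA Nf S μ Γ' * transportA Nf S μ Γ := by
  rw [transportA, transportA, transportA, List.map_append, List.reverse_append, List.prod_append]

end Transport

/-! ## §2 The two-sided kernel block on one level -/

section OneLevel

variable (Nf : Fin d → ℕ) [hNf : ∀ μ, NeZero (Nf μ)]

/-- [folklore] **THE ADJOINT COVARIANT DIFFERENCE** `c̄·((S_ν ⊗ 1)ᴴ·siteMul(S ν) − 1)` — the formula of `(covDc c R ν)ᴴ` with `(R ν ·)ᴴ ↦ S ν ·`. -/
def covDcA (c : ℂ) (S : Fin d → (Tor Nf × Fin d → Matrix o o ℂ)) (ν : Fin d) :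
    Matrix ((Tor Nf × Fin d) × o) ((Tor Nf × Fin d) × o) ℂ :=
  conj c • ((shiftM Nf ν ⊗ₖ (1 : Matrix o o ℂ))ᴴ * siteMul (S ν) - 1)

/-- [folklore] **REAL SLICE**: `covDcA c (adjOf R) ν = (covDc c R ν)ᴴ`. -/
theorem covDcA_adjOf (c : ℂ) (R : Fin d → (Tor Nf × Fin d → Matrix o o ℂ)) (ν : Fin d) :
    covDcA Nf c (adjOf R) ν = (covDc Nf c R ν)ᴴ := by
  rw [covDcA, covDc, Matrix.conjTranspose_smul, Matrix.conjTranspose_sub, Matrix.conjTranspose_one, Matrix.conjTranspose_mul,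
    siteMul_conjTranspose]
  rfl

/-- [folklore] **THE TWO-SIDED COVARIANT VECTOR LAPLACIAN** `Δ(R, S) := Σ_ν ∇ᴬ_ν(S)·∇_ν(R)` — polynomial in `(R, S)`. -/
def covLapT (c : ℂ) (R S : Fin d → (Tor Nf × Fin d → Matrix o o ℂ)) : Matrix ((Tor Nf × Fin d) × o) ((Tor Nf × Fin d) × o) ℂ :=
  ∑ ν, covDcA Nf c S ν * covDc Nf c R ν

/-- [folklore] **REAL SLICE**: `covLapT c R (adjOf R) = covLapC c R` (NE2's `Σ_ν (∇^R_ν)ᴴ ∇^R_ν`). -/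
theorem covLapT_adjOf (c : ℂ) (R : Fin d → (Tor Nf × Fin d → Matrix o o ℂ)) : covLapT Nf c R (adjOf R) = covLapC Nf c R := by
  unfold covLapT covLapC
  exact Finset.sum_congr rfl fun ν _ => by rw [covDcA_adjOf]

end OneLevel

section Block

variable (n : ℕ) [NeZero n] (M : Fin d → ℕ) [hM : ∀ μ, NeZero (M μ)]

/-- [folklore] **THE ADJOINT COVARIANT BLOCK AVERAGING** `Qᴬ(S)` — the formula of `(Qcov Γ R)ᴴ` with each transport replaced by the adjoint
transport of `S` (the weights `n^{−(d+1)}` are real). -/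
def QcovA (Γ : ContourSystem d n M) (S : Fin d → (Tor (fine n M) × Fin d → Matrix o o ℂ)) :
    Matrix ((Tor (fine n M) × Fin d) × o) ((Tor M × Fin d) × o) ℂ :=
  fun i b => if i.1.2 = b.1.2 then
      ∑ j : Fin d → Fin n, ∑ t : Fin n,
        (if i.1.1 = bpt n M b.1.1 j + tstep (fine n M) b.1.2 t then
          (1 / (n : ℂ) ^ (d + 1)) * transportA (fine n M) S b.1.2 (Γ b.1.1 j b.1.2 t) i.2 b.2 else 0)
    else 0

omit [NeZero n] hM in
/-- [folklore] **REAL SLICE**: `QcovA Γ (adjOf R) = (Qcov Γ R)ᴴ`. -/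
theorem QcovA_adjOf (Γ : ContourSystem d n M) (R : Fin d → (Tor (fine n M) × Fin d → Matrix o o ℂ)) :
    QcovA n M Γ (adjOf R) = (Qcov n M Γ R)ᴴ := by
  ext i b
  rw [Matrix.conjTranspose_apply, QcovA, Qcov]
  by_cases h : i.1.2 = b.1.2
  · rw [if_pos h, if_pos h, star_sum]
    refine Finset.sum_congr rfl fun j _ => ?_
    rw [star_sum]
    refine Finset.sum_congr rfl fun t _ => ?_
    by_cases h' : i.1.1 = bpt n M b.1.1 j + tstep (fine n M) b.1.2 t
    · rw [if_pos h', if_pos h', star_mul', transportA_adjOf, Matrix.conjTranspose_apply]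
      congr 1
      simp
    · rw [if_neg h', if_neg h', star_zero]
  · rw [if_neg h, if_neg h, star_zero]

/-- [folklore] **THE TWO-SIDED FLUCTUATION OPERATOR** `ΔQ(R, S) := Δ(R, S) + a·Qᴬ(S)·Q(R)` ((3.24)-type, without the gauge term). -/
def deltaQT (c : ℂ) (a : ℝ) (Γ : ContourSystem d n M) (R S : Fin d → (Tor (fine n M) × Fin d → Matrix o o ℂ)) :
    Matrix ((Tor (fine n M) × Fin d) × o) ((Tor (fine n M) × Fin d) × o) ℂ :=
  covLapT (fine n M) c R S + (a : ℂ) • (QcovA n M Γ S * Qcov n M Γ R)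

/-- [folklore] **REAL SLICE**: `deltaQT c a Γ R (adjOf R) = covLapC c R + a·(Qcov Γ R)ᴴ·Qcov Γ R`. -/
theorem deltaQT_adjOf (c : ℂ) (a : ℝ) (Γ : ContourSystem d n M) (R : Fin d → (Tor (fine n M) × Fin d → Matrix o o ℂ)) :
    deltaQT n M c a Γ R (adjOf R) = covLapC (fine n M) c R + (a : ℂ) • ((Qcov n M Γ R)ᴴ * Qcov n M Γ R) := by
  rw [deltaQT, covLapT_adjOf, QcovA_adjOf]

/-- [folklore] **THE TWO-SIDED GREEN'S FUNCTION** `G(R, S) := ΔQ(R, S)⁻¹` (Mathlib's total inverse; invertibility NOT claimed). -/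
def greenT (c : ℂ) (a : ℝ) (Γ : ContourSystem d n M) (R S : Fin d → (Tor (fine n M) × Fin d → Matrix o o ℂ)) :
    Matrix ((Tor (fine n M) × Fin d) × o) ((Tor (fine n M) × Fin d) × o) ℂ :=
  (deltaQT n M c a Γ R S)⁻¹

/-- [folklore] **THE TWO-SIDED UNIT-LATTICE COVARIANCE** `C(R, S) := s·Q(R)·G(R, S)·Qᴬ(S)`. -/
def unitCovT (c : ℂ) (a : ℝ) (s : ℂ) (Γ : ContourSystem d n M) (R S : Fin d → (Tor (fine n M) × Fin d → Matrix o o ℂ)) :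
    Matrix ((Tor M × Fin d) × o) ((Tor M × Fin d) × o) ℂ :=
  s • (Qcov n M Γ R * greenT n M c a Γ R S * QcovA n M Γ S)

end Block

/-! ## §3 Agreement with the species of record on the real slice -/

section Record

variable (P : Params) {G : Type*} [GaugeGroup G] (ι : G →* Matrix o o ℂ) {j k : ℕ} (h : j + k = P.K)

/-- [folklore] The covariant Laplacian of record IS the two-sided one at `(R, adjOf R)`, `R = transV e ι U`. -/
theorem covLapOf_eq_covLapT {N : Fin P.d → ℕ} [∀ μ, NeZero (N μ)] (e : Site P j ≃ Tor N) (c : ℂ) (U : GaugeField P j G) :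
    covLapOf e ι c U = covLapT N c (transV e ι U) (adjOf (transV e ι U)) := by
  rw [covLapOf, covLapT_adjOf]

/-- [folklore] **D-8 (i) for the fluctuation operator**: `deltaQOf P ι h c a Γ U = deltaQT … c a Γ R (adjOf R)` with `R := transV (siteIdx P h) ι U`. -/
theorem deltaQOf_eq_deltaQT (c : ℂ) (a : ℝ) (Γ : ContourSystem P.d (lev P.L k) (unitMod P)) (U : GaugeField P j G) :
    deltaQOf P ι h c a Γ U =
      deltaQT (lev P.L k) (unitMod P) c a Γ (transV (siteIdx P h) ι U) (adjOf (transV (siteIdx P h) ι U)) := by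
  rw [deltaQOf, deltaQT_adjOf, covLapOf, QcovOf]

/-- [folklore] D-8 (i) for the Green's function of record. -/
theorem greenOf_eq_greenT (c : ℂ) (a : ℝ) (Γ : ContourSystem P.d (lev P.L k) (unitMod P)) (U : GaugeField P j G) :
    greenOf P ι h c a Γ U =
      greenT (lev P.L k) (unitMod P) c a Γ (transV (siteIdx P h) ι U) (adjOf (transV (siteIdx P h) ι U)) := by
  rw [greenOf, greenT, deltaQOf_eq_deltaQT]

/-- [folklore] **D-8 (i): THE COVARIANCE SPECIES OF RECORD FACTORS THROUGH THE TRANSPORTER DATA** — `unitCovOf P ι h c a s Γ U = unitCovT …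
c a s Γ R (adjOf R)`, `R := transV (siteIdx P h) ι U`; so `Slots.rawB`'s `.cov` block (`covAtOfRecord`, `rawBOfRecord`) is the REAL SLICE of the
two-sided species. -/
theorem unitCovOf_eq_unitCovT (c : ℂ) (a : ℝ) (s : ℂ) (Γ : ContourSystem P.d (lev P.L k) (unitMod P)) (U : GaugeField P j G) :
    unitCovOf P ι h c a s Γ U =
      unitCovT (lev P.L k) (unitMod P) c a s Γ (transV (siteIdx P h) ι U) (adjOf (transV (siteIdx P h) ι U)) := by
  rw [unitCovOf, unitCovT, greenOf_eq_greenT, QcovA_adjOf, QcovOf]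

/-- [folklore] On the group the second variable is the INVERSE field: for unitary-valued `ι`,
`adjOf (transV e ι U) = fun ν i => (transV e ι U ν i)⁻¹` ([Balaban1985BackgroundPropagators] Sect. B «U* → U⁻¹», KIND). -/
theorem adjOf_transV {N : Fin P.d → ℕ} (e : Site P j ≃ Tor N) (hι : ∀ g, ι g ∈ Matrix.unitaryGroup o ℂ) (U : GaugeField P j G) :
    adjOf (transV e ι U) = fun ν i => (transV e ι U ν i)⁻¹ :=
  adjOf_eq_inv fun ν i => transV_mem_unitaryGroup e hι U ν i

end Record

/-! ## §4 The exponential chart at a reference transporter field -/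

section Chart

variable {ι : Type*}

/-- [folklore] **THE EXPONENTIAL CHART** at the reference field `R⁰`: `(expChart R⁰ A) ν i := exp (A ν i) · R⁰ ν i` — complex matrices `A`
(the complexified algebra after `ι`); its real form is skew-Hermitian `A` ([Balaban1985BackgroundPropagators] Sect. B «U′U, U′ = e^{iηA}», KIND). -/
def expChart (R₀ A : Fin d → (ι → Matrix o o ℂ)) : Fin d → (ι → Matrix o o ℂ) := fun ν i => NormedSpace.exp (A ν i) * R₀ ν i

/-- [folklore] **THE INVERSE-SIDE CHART**: `(expChartInv R⁰ A) ν i := (R⁰ ν i)⁻¹ · exp (−A ν i)` — the second variable `S` along the chart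
(no matrix inversion of a variable: `exp (−A)`), equal to `adjOf (expChart R⁰ A)` on the real form (`adjOf_expChart`). -/
def expChartInv (R₀ A : Fin d → (ι → Matrix o o ℂ)) : Fin d → (ι → Matrix o o ℂ) :=
  fun ν i => (R₀ ν i)⁻¹ * NormedSpace.exp (-(A ν i))

/-- [folklore] `expChart` unfolds. -/
@[simp] theorem expChart_apply (R₀ A : Fin d → (ι → Matrix o o ℂ)) (ν : Fin d) (i : ι) :
    expChart R₀ A ν i = NormedSpace.exp (A ν i) * R₀ ν i := rfl

/-- [folklore] `expChartInv` unfolds. -/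
@[simp] theorem expChartInv_apply (R₀ A : Fin d → (ι → Matrix o o ℂ)) (ν : Fin d) (i : ι) :
    expChartInv R₀ A ν i = (R₀ ν i)⁻¹ * NormedSpace.exp (-(A ν i)) := rfl

/-- [folklore] The chart is centred at `R⁰`: `expChart R⁰ 0 = R⁰`. -/
theorem expChart_zero (R₀ : Fin d → (ι → Matrix o o ℂ)) : expChart R₀ 0 = R₀ := by
  funext ν i; simp [expChart, NormedSpace.exp_zero]

/-- [folklore] `expChartInv R⁰ 0 = (R⁰)⁻¹` pointwise. -/
theorem expChartInv_zero (R₀ : Fin d → (ι → Matrix o o ℂ)) : expChartInv R₀ 0 = fun ν i => (R₀ ν i)⁻¹ := by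
  funext ν i; simp [expChartInv, NormedSpace.exp_zero]

/-- [folklore] `exp (−A) · exp A = 1` for complex matrices. -/
theorem exp_neg_mul_exp (A : Matrix o o ℂ) : NormedSpace.exp (-A) * NormedSpace.exp A = 1 := by
  rw [← Matrix.exp_add_of_commute (-A) A ((Commute.refl A).neg_left), neg_add_cancel, NormedSpace.exp_zero]

/-- [folklore] `exp A · exp (−A) = 1` for complex matrices. -/
theorem exp_mul_exp_neg (A : Matrix o o ℂ) : NormedSpace.exp A * NormedSpace.exp (-A) = 1 := by
  rw [← Matrix.exp_add_of_commute A (-A) ((Commute.refl A).neg_right), add_neg_cancel, NormedSpace.exp_zero]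

/-- [folklore] **THE TWO CHART VARIABLES ARE MUTUALLY INVERSE** (invertible reference field): `expChartInv R⁰ A ν i * expChart R⁰ A ν i = 1`. -/
theorem expChartInv_mul_expChart {R₀ : Fin d → (ι → Matrix o o ℂ)} (hR : ∀ ν i, IsUnit (R₀ ν i).det)
    (A : Fin d → (ι → Matrix o o ℂ)) (ν : Fin d) (i : ι) : expChartInv R₀ A ν i * expChart R₀ A ν i = 1 := by
  rw [expChartInv_apply, expChart_apply, Matrix.mul_assoc, ← Matrix.mul_assoc (NormedSpace.exp (-(A ν i))), exp_neg_mul_exp,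
    Matrix.one_mul, Matrix.nonsing_inv_mul _ (hR ν i)]

/-- [folklore] … and `expChart R⁰ A ν i * expChartInv R⁰ A ν i = 1`. -/
theorem expChart_mul_expChartInv {R₀ : Fin d → (ι → Matrix o o ℂ)} (hR : ∀ ν i, IsUnit (R₀ ν i).det)
    (A : Fin d → (ι → Matrix o o ℂ)) (ν : Fin d) (i : ι) : expChart R₀ A ν i * expChartInv R₀ A ν i = 1 := by
  rw [expChartInv_apply, expChart_apply, Matrix.mul_assoc, ← Matrix.mul_assoc (R₀ ν i), Matrix.mul_nonsing_inv _ (hR ν i),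
    Matrix.one_mul, exp_mul_exp_neg]

/-- [folklore] Unitary matrices have unit determinant (as an `IsUnit`). -/
theorem isUnit_det_of_mem_unitaryGroup {U : Matrix o o ℂ} (hU : U ∈ Matrix.unitaryGroup o ℂ) : IsUnit U.det :=
  Matrix.isUnit_det_of_left_inverse (Matrix.mem_unitaryGroup_iff'.1 hU)

/-- [folklore] **THE REAL FORM OF THE CHART LANDS ON THE REAL SLICE, I**: for unitary `R⁰` and skew-Hermitian `A` (`(A ν i)ᴴ = −A ν i`),
`adjOf (expChart R⁰ A) = expChartInv R⁰ A` — the adjoint field of the chart point IS the inverse-side chart point. -/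
theorem adjOf_expChart {R₀ : Fin d → (ι → Matrix o o ℂ)} (hR : ∀ ν i, R₀ ν i ∈ Matrix.unitaryGroup o ℂ)
    {A : Fin d → (ι → Matrix o o ℂ)} (hA : ∀ ν i, (A ν i)ᴴ = -(A ν i)) : adjOf (expChart R₀ A) = expChartInv R₀ A := by
  funext ν i
  rw [adjOf_apply, expChart_apply, expChartInv_apply, Matrix.conjTranspose_mul, ← Matrix.exp_conjTranspose, hA ν i]
  congr 1
  have h : star (R₀ ν i) * R₀ ν i = 1 := Matrix.mem_unitaryGroup_iff'.1 (hR ν i)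
  rw [← Matrix.star_eq_conjTranspose]
  exact (Matrix.inv_eq_left_inv h).symm

/-- [folklore] **THE REAL FORM OF THE CHART LANDS ON THE REAL SLICE, II**: for unitary `R⁰` and skew-Hermitian `A` every chart transporter is
unitary — the real form of the chart parametrises (a neighbourhood in) the V2 transporter data of GROUP-valued configurations. -/
theorem expChart_mem_unitaryGroup {R₀ : Fin d → (ι → Matrix o o ℂ)} (hR : ∀ ν i, R₀ ν i ∈ Matrix.unitaryGroup o ℂ)
    {A : Fin d → (ι → Matrix o o ℂ)} (hA : ∀ ν i, (A ν i)ᴴ = -(A ν i)) (ν : Fin d) (i : ι) :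
    expChart R₀ A ν i ∈ Matrix.unitaryGroup o ℂ := by
  rw [Matrix.mem_unitaryGroup_iff', Matrix.star_eq_conjTranspose]
  have h1 : (expChart R₀ A ν i)ᴴ = expChartInv R₀ A ν i := by
    have := congrArg (fun F => F ν i) (adjOf_expChart hR hA); simpa using this
  rw [h1]
  exact expChartInv_mul_expChart (fun ν i => isUnit_det_of_mem_unitaryGroup (hR ν i)) A ν i

end Chart

/-! ## §5 The tower: two-sided data per NE2 level, the covariance family and raw record on it, agreement with the record -/

section Tower

variable (P : Params) {G : Type*} [GaugeGroup G] (ι : G →* Matrix o o ℂ) (av : ∀ j, Averaging P j G) (c : ℂ) (a : ℝ) (s : ℕ → ℂ)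
  (Γ : (k : ℕ) → ContourSystem P.d (lev P.L k) (unitMod P))

/-- [folklore] **TOWER TRANSPORTER DATA**: one transporter field on the level-`k` unit-lattice chart per NE2 level `k ≤ K` — the (finite-
dimensional) domain of the complex chart of [dict] D-8 (iii) («bonds ∕ levels → M_o(ℂ)»). -/
abbrev TowerData (P : Params) (o : Type*) : Type _ :=
  (k : Fin (P.K + 1)) → Fin P.d → (Tor (fine (lev P.L k) (unitMod P)) × Fin P.d → Matrix o o ℂ)

/-- [folklore] **THE TOWER DATA OF RECORD of a finest-lattice configuration `U`**: at NE2 level `k ≤ K` the transporters (after `ι`) of the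
`(K−k)`-fold BLOCK AVERAGE `M^{K−k} U` in the level-`k` chart — exactly the backgrounds `covAtOfRecord` reads. -/
def towerDataOf (U : GaugeField P 0 G) : TowerData P o :=
  fun k => transV (siteIdx P (j := P.K - k) (k := k) (by have := k.2; omega)) ι (Averaging.iter av (P.K - k) U)

/-- [folklore] **THE TWO-SIDED COVARIANCE FAMILY ON TOWER DATA**: at NE2 level `k ≤ K` the entries of `unitCovT` at `(R k, S k)` (levels
`k > K`: `0`). -/
def covAtT (R S : TowerData P o) (k : ℕ) {T : Type*} (_t : T) (b b' : (Tor (unitMod P) × Fin P.d) × o) : ℂ :=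
  if hk : k ≤ P.K then
    unitCovT (lev P.L k) (unitMod P) c a (s k) (Γ k) (R ⟨k, Nat.lt_succ_of_le hk⟩) (S ⟨k, Nat.lt_succ_of_le hk⟩) b b'
  else 0

/-- [folklore] **D-8 (i) AT THE RECORD LEVEL: `covAtOfRecord` IS THE REAL SLICE OF `covAtT` AT THE TOWER DATA OF RECORD** —
`covAtOfRecord P ι av c a s Γ U k = covAtT P c a s Γ R (adjOf ∘ R) k` with `R := towerDataOf P ι av U`. -/
theorem covAtOfRecord_eq_covAtT (U : GaugeField P 0 G) (k : ℕ) {T : Type*} (t : T) (b b' : (Tor (unitMod P) × Fin P.d) × o) :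
    SubstrateRawSpecies.covAtOfRecord P ι av c a s Γ U k t b b' =
      covAtT P c a s Γ (towerDataOf P ι av U) (fun k => adjOf (towerDataOf P ι av U k)) k t b b' := by
  unfold SubstrateRawSpecies.covAtOfRecord covAtT
  by_cases hk : k ≤ P.K
  · rw [dif_pos hk, dif_pos hk, unitCovOf_eq_unitCovT]
    rfl
  · rw [dif_neg hk, dif_neg hk]

variable {T ι' Ω 𝒴 : Type*}

/-- [folklore] **THE RAW RECORD ON TWO-SIDED TOWER DATA** (`RS = (R, S)`): `.cov := covAtT` (coupling-IDLE); the other four species are LETTER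
TABLES on `(last coupling, R, S, level)` — the D-8 reading of `rawOfRecord`'s letters. -/
def rawTOfRecord (dk : TowerData P o → TowerData P o → ℕ → T → ι' → ι' → ℂ)
    (gc : TowerData P o → TowerData P o → ℕ → T → ((Tor (unitMod P) × Fin P.d) × o) → ι' → ℂ)
    (pQ : ℝ → TowerData P o → TowerData P o → ℕ → Ω → 𝒴 → ((Tor (unitMod P) × Fin P.d) × o) → ((Tor (unitMod P) × Fin P.d) × o) → ℂ)
    (pR : ℝ → TowerData P o → TowerData P o → ℕ → Ω → 𝒴 → ℂ) :
    (ℕ → ℝ) → TowerData P o × TowerData P o → ℕ → RawSpecies T ((Tor (unitMod P) × Fin P.d) × o) ι' Ω 𝒴 :=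
  SubstrateRawSpecies.rawOfGreen (fun _ RS k => covAtT P c a s Γ RS.1 RS.2 k) (fun _ RS k => dk RS.1 RS.2 k) (fun _ RS k => gc RS.1 RS.2 k)
    (fun g RS k => pQ (g (k - 1)) RS.1 RS.2 k) (fun g RS k => pR (g (k - 1)) RS.1 RS.2 k)

variable {dk : TowerData P o → TowerData P o → ℕ → T → ι' → ι' → ℂ}
  {gc : TowerData P o → TowerData P o → ℕ → T → ((Tor (unitMod P) × Fin P.d) × o) → ι' → ℂ}
  {pQ : ℝ → TowerData P o → TowerData P o → ℕ → Ω → 𝒴 → ((Tor (unitMod P) × Fin P.d) × o) → ((Tor (unitMod P) × Fin P.d) × o) → ℂ}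
  {pR : ℝ → TowerData P o → TowerData P o → ℕ → Ω → 𝒴 → ℂ}

/-- [folklore] [dict] D-6 holds for the two-sided raw record BY CONSTRUCTION. -/
theorem lastCouplingOnly_rawTOfRecord : SubstrateRawSpecies.LastCouplingOnly (rawTOfRecord P c a s Γ dk gc pQ pR) := by
  intro g g' RS k hg
  simp only [rawTOfRecord, SubstrateRawSpecies.rawOfGreen, Nat.add_sub_cancel, hg]

/-- [folklore] **THE RAW RECORD OF RECORD IS THE REAL SLICE OF THE TWO-SIDED ONE**: with letters READ THROUGH the tower data of record
(`dk′ U k := dk R (adjOf ∘ R) k`, …, `R := towerDataOf P ι av U`), `rawOfRecord … g U k = rawTOfRecord … g (R, adjOf ∘ R) k`. -/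
theorem rawOfRecord_eq_rawTOfRecord (g : ℕ → ℝ) (U : GaugeField P 0 G) (k : ℕ) :
    SubstrateRawSpecies.rawOfRecord P ι av c a s Γ
        (fun U k => dk (towerDataOf P ι av U) (fun k => adjOf (towerDataOf P ι av U k)) k)
        (fun U k => gc (towerDataOf P ι av U) (fun k => adjOf (towerDataOf P ι av U k)) k)
        (fun r U k => pQ r (towerDataOf P ι av U) (fun k => adjOf (towerDataOf P ι av U k)) k)
        (fun r U k => pR r (towerDataOf P ι av U) (fun k => adjOf (towerDataOf P ι av U k)) k) g U k =
      rawTOfRecord P c a s Γ dk gc pQ pR g (towerDataOf P ι av U, fun k => adjOf (towerDataOf P ι av U k)) k := by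
  have hc : @SubstrateRawSpecies.covAtOfRecord P G _ o _ _ ι av c a s Γ U k T =
      fun t => covAtT P c a s Γ (towerDataOf P ι av U) (fun k => adjOf (towerDataOf P ι av U k)) k t := by
    funext t b b'; exact covAtOfRecord_eq_covAtT P ι av c a s Γ U k t b b'
  unfold SubstrateRawSpecies.rawOfRecord rawTOfRecord SubstrateRawSpecies.rawOfGreen
  dsimp only
  rw [RawSpecies.mk.injEq]
  exact ⟨hc, rfl, rfl, rfl, rfl⟩

end Tower

end Summit.QuantumFields.BalabanUV.T4Continuum.SubstrateTransporterSpecies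

end
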